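import Literature.NumberTheory.LFunctions.MertensSecondLogPower
import Literature.NumberTheory.LFunctions.RosserSchoenfeldMertensFirstProofs
import Literature.Analysis.SpecialFunctions.KernelLog
import Literature.Analysis.SpecialFunctions.EulerMascheroniBounds
import HarnessLib

/-!
# `∑_{p ≤ x} 1/p ≤ log log x + γ` for `x ≥ 5` (Choie–Lichiardopol–Moree–Solé 2007, Lemma 2.1 (2)),
# unconditionally, with a one-sided explicit Mertens second theorem

Topic `Literature/NumberTheory/LFunctions`. Everything in this file is PROVED (theorems; the only
`def`s are kernel-evaluable checkers and their constants; no named fact).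

Y. Choie, N. Lichiardopol, P. Moree, P. Solé, *On Robin's criterion for the Riemann hypothesis*,
J. Théor. Nombres Bordeaux 19 (2007) 357–372, Lemma 2.1: "1) For `x ≥ 2` we have
`∑_{p≤x} 1/p = log log x + B + O(1/log x)`, where the implicit constant … does not exceed
`2(1 + log 4) < 5` …; 2) For `x ≥ 5` we have `∑_{p≤x} 1/p ≤ log log x + γ`." Part 2 is the one
analytic input ("the deepest input", p. 358) of their elementary Theorems 1.1–1.3 (Robin's inequality
`σ(n) < e^γ n log log n` for every squarefree `n ∉ {2,3,5,6,10,30}` and every odd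
`n ∉ {1,3,5,9}`). Their proof of 2): a check for the primes `5 ≤ p ≤ 3 673 337` plus part 1 with
`B + 2(1 + log 4)/log 3673337 < γ`.

Here part 2 is proved for all real `x ≥ 4` (`primeRecipSum_le_loglog_add_eulerMascheroni`; the
printed range `x ≥ 5` is `CLMS2007_lemma_2_1_2`) by a route adapted to what the tree proves:

* **One-sided Mertens II** (`primeRecipSum_le_loglog_add`): for `x ≥ 2`,
  `∑_{p≤x} 1/p ≤ log log x + B₁ + (1.8615 + 1/⌊x⌋)/log x`. Proof: the exact formula
  `∑_{p≤x} 1/p − log log x − B₁ = τ(x)/log x − ∫_x^∞ τ(t) dt/(t log² t)`,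
  `τ(t) = ∑_{p≤t} log p/p − log t` (the tree's `Mertens.primeRecipSum_sub_loglog_sub_eq`, Hardy–Wright
  (22.7.3)), the PROVED upper bound `τ < 0` (Rosser–Schoenfeld 1962 (3.24),
  `RosserSchoenfeld1962_eq_3_24_holds`) and the elementary lower bound
  `τ(t) ≥ −(1 + C₁) − 1/⌊t⌋` (`mertensTau_ge`) with **`∑_p log p/(p(p−1)) ≤ C₁ = 0.8615`**
  (`sum_primesLE_log_div_mul_pred_le`: the primes `≤ 47` by kernel logarithms, the rest by the
  tree's telescoping device `log k/(k(k−1)) ≤ F(k−1) − F(k)`, `F(m) = (2 + log m)/m`, of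
  `MertensTail.lean`, whose constant `2` this sharpens). The tree's two-sided remainder is `8/log x`
  (`Mertens.abs_primeRecipSum_sub_le`); one-sidedness buys the factor `4`.
* **`γ − B₁ ≥ 0.3113`** (`eulerMascheroni_sub_meisselMertens_ge`; so `B₁ < 0.2660`,
  `meisselMertens_lt`): `γ − B₁ = ∑_p (−log(1 − 1/p) − 1/p)` (Hardy–Wright (22.8.1); tree:
  `Mertens.meisselMertens`, `Mertens.tsum_primeLogCoeffSubInv`) and
  `−log(1 − 1/p) − 1/p ≥ ∑_{2≤j≤J} 1/(j p^j)` for the primes `p ≤ 23`.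
* Hence `∑_{p≤x} 1/p ≤ log log x + γ` for `x ≥ 420` (`(1.8615 + 1/420)/log 420 ≤ 0.3113`), and the
  range `4 ≤ ⌊x⌋ < 420` is a **kernel computation** (`checkGo`, `check_4_420`: the prime sum in
  `2⁻⁸⁰` fixed point rounded up, `log log n` rounded down through two evaluations of the tree's
  kernel logarithm `KernelLog.logIv`, `γ > 0.57721558` from `EulerMascheroniBounds.lean`;
  primality by trial division `isPrimeB`, proved equivalent to `Nat.Prime`).

Not here: CLMS Theorems 1.1–1.6 themselves (Robin's inequality on squarefree / odd / squarefull /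
5-free integers); Rosser–Schoenfeld's two-sided (3.17)–(3.20) (which need their Theorem 6, i.e.
explicit prime number theorem input — tree: named facts `RosserSchoenfeld1962_eq_3_21/22`).

## References

* Y. Choie, N. Lichiardopol, P. Moree, P. Solé, J. Théor. Nombres Bordeaux 19 (2007) 357–372,
  §2, Lemma 2.1 (journal numbering; arXiv:math/0604314, §2 "Lemma 1"). [CLMS2007]
* J. B. Rosser, L. Schoenfeld, Illinois J. Math. 6 (1962) 64–94, (3.24) and (3.20). [RosserSchoenfeld1962]
* G. H. Hardy, E. M. Wright, *An Introduction to the Theory of Numbers*, 6th ed., §22.7 (22.7.3),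
  Thm 428. [HardyWright2008]
-/

noncomputable section

open Finset Real MeasureTheory Set

namespace Literature.NumberTheory.LFunctions

open Mertens
open Literature.Analysis.SpecialFunctions.KernelLog (logIv logIv_sound L2HI)

namespace PrimeRecipSumBound

/-! ### 1. The telescoping tail `∑_{M < k ≤ n} log k/(k(k−1)) ≤ F(M) − F(n)` -/

/-- `∑_{M < k ≤ n} log k/(k(k−1)) ≤ (2 + log M)/M − (2 + log n)/n` for `1 ≤ M ≤ n` (the tree's
telescoping bound `log k/(k(k−1)) ≤ F(k−1) − F(k)`, `F(m) = (2 + log m)/m`, summed from `M`).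
[folklore] -/
private theorem sum_Icc_log_div_mul_pred_le_from (M : ℕ) (hM : 1 ≤ M) :
    ∀ n, M ≤ n → ∑ k ∈ Icc (M + 1) n, Real.log k / (k * (k - 1)) ≤
      (2 + Real.log M) / M - (2 + Real.log n) / n := by
  intro n hn
  induction n, hn using Nat.le_induction with
  | base => simp
  | succ m hm ih =>
    rw [Finset.sum_Icc_succ_top (by omega), Nat.cast_succ]
    have h := MertensBound.log_div_mul_pred_le_sub (m + 1) (by omega)
    simp only [Nat.add_sub_cancel, Nat.cast_succ, add_sub_cancel_right] at h
    simp only [add_sub_cancel_right]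
    linarith

/-- The terms `log k/(k(k−1))` are nonnegative for `k ≥ 2` (as naturals, for all `k`: at `k = 0, 1`
the real expression is `0`). [folklore] -/
private theorem log_div_mul_pred_nonneg (k : ℕ) : 0 ≤ Real.log k / (k * (k - 1)) := by
  rcases Nat.lt_or_ge k 2 with hk | hk
  · interval_cases k <;> simp
  · have hk' : (2 : ℝ) ≤ k := by exact_mod_cast hk
    exact div_nonneg (Real.log_nonneg (by linarith)) (by nlinarith)

/-! ### 2. Trial division, proved equivalent to primality -/

/-- `hasDivFrom n fuel d`: does some `e` with `d ≤ e < d + fuel` divide `n`? [folklore] -/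
def hasDivFrom (n : ℕ) : ℕ → ℕ → Bool
  | 0, _ => false
  | fuel + 1, d => (n % d).beq 0 || hasDivFrom n fuel (d + 1)

/-- Primality by trial division over `2 ≤ d < n`. [folklore] -/
def isPrimeB (n : ℕ) : Bool := Nat.ble 2 n && !hasDivFrom n (n - 2) 2

/-- Specification of `hasDivFrom`. [folklore] -/
private theorem hasDivFrom_iff (n : ℕ) : ∀ fuel d : ℕ,
    hasDivFrom n fuel d = true ↔ ∃ e, d ≤ e ∧ e < d + fuel ∧ e ∣ n
  | 0, d => by
      simp only [hasDivFrom, Bool.false_eq_true, false_iff, not_exists, not_and]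
      intro e h1 h2; omega
  | fuel + 1, d => by
      rw [hasDivFrom, Bool.or_eq_true, hasDivFrom_iff n fuel (d + 1), Nat.beq_eq]
      constructor
      · rintro (h | ⟨e, h1, h2, h3⟩)
        · exact ⟨d, le_rfl, by omega, Nat.dvd_of_mod_eq_zero h⟩
        · exact ⟨e, by omega, by omega, h3⟩
      · rintro ⟨e, h1, h2, h3⟩
        rcases Nat.eq_or_lt_of_le h1 with rfl | hlt
        · exact Or.inl (Nat.mod_eq_zero_of_dvd h3)
        · exact Or.inr ⟨e, hlt, by omega, h3⟩

/-- `isPrimeB n = true ↔ n` is prime. [folklore] -/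
private theorem isPrimeB_iff (n : ℕ) : isPrimeB n = true ↔ n.Prime := by
  rw [isPrimeB, Bool.and_eq_true, Nat.ble_eq, Bool.not_eq_true', Nat.prime_def_lt']
  have h := hasDivFrom_iff n (n - 2) 2
  constructor
  · rintro ⟨h2, hd⟩
    refine ⟨h2, fun m hm1 hm2 hm3 => ?_⟩
    have : hasDivFrom n (n - 2) 2 = true := h.2 ⟨m, hm1, by omega, hm3⟩
    rw [hd] at this
    exact Bool.false_ne_true this
  · rintro ⟨h2, hd⟩
    refine ⟨h2, ?_⟩
    cases hh : hasDivFrom n (n - 2) 2 with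
    | false => rfl
    | true =>
      obtain ⟨e, he1, he2, he3⟩ := h.1 hh
      exact absurd he3 (hd e he1 (by omega))

/-! ### 3. Kernel head sum: `∑_{p ≤ 47} log p/(p(p−1))` and the constant `C₁` -/

/-- The fixed-point scale `2⁸⁰`. [folklore] -/
def SC : ℕ := 2 ^ 80

/-- Head accumulator: over `k, k+1, …` (`fuel` steps), add `⌊hi_k/(k(k−1))⌋ + 1` for each prime
`k`, where `hi_k/2⁸⁰ ≥ log k` is the kernel enclosure `logIv k`; `none` if an enclosure fails.
[folklore] -/
def headGo : ℕ → ℕ → ℤ → Option ℤ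
  | 0, _, acc => some acc
  | fuel + 1, k, acc =>
      if isPrimeB k = true then
        match logIv k with
        | none => none
        | some (_, hi) => headGo fuel (k + 1) (acc + (hi / ((k * (k - 1) : ℕ) : ℤ) + 1))
      else headGo fuel (k + 1) acc

/-- The check `2⁸⁰ · (∑_{p ≤ M} log p/(p(p−1)) + (2 + log M)/M) ≤ C` (all roundings outward).
[folklore] -/
def headCheck (M : ℕ) (C : ℤ) : Bool :=
  match headGo (M - 1) 2 0, logIv M with
  | some A, some (_, hiM) => decide (A + ((2 * (SC : ℤ) + hiM) / (M : ℤ) + 1) ≤ C)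
  | _, _ => false

/-- Floor division in `ℤ` by a positive natural, as a real inequality: `t/d ≤ ⌊t/d⌋ + 1`.
[folklore] -/
private theorem div_le_ediv_add_one (t : ℤ) {d : ℕ} (hd : 0 < d) :
    (t : ℝ) / d ≤ ((t / (d : ℤ) : ℤ) : ℝ) + 1 := by
  have h := (Literature.Analysis.SpecialFunctions.KernelLog.ediv_bounds_real t (d : ℤ)
    (by exact_mod_cast hd)).2
  exact_mod_cast h

/-- Soundness of `headGo`: it over-estimates `2⁸⁰ ∑_{p < k + fuel} log p/(p(p−1))` given an
over-estimate of `2⁸⁰ ∑_{p < k} log p/(p(p−1))`. [folklore] -/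
private theorem headGo_sound : ∀ (fuel k : ℕ) (acc A : ℤ), headGo fuel k acc = some A →
    (SC : ℝ) * ∑ p ∈ Nat.primesBelow k, Real.log p / (p * (p - 1)) ≤ acc →
    (SC : ℝ) * ∑ p ∈ Nat.primesBelow (k + fuel), Real.log p / (p * (p - 1)) ≤ A
  | 0, k, acc, A, h, hinv => by
      simp only [headGo, Option.some.injEq] at h
      subst h; simpa using hinv
  | fuel + 1, k, acc, A, h, hinv => by
      rw [headGo] at h
      have hstep : ∀ acc' : ℤ, headGo fuel (k + 1) acc' = some A →
          (SC : ℝ) * ∑ p ∈ Nat.primesBelow (k + 1), Real.log p / (p * (p - 1)) ≤ acc' →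
          (SC : ℝ) * ∑ p ∈ Nat.primesBelow (k + (fuel + 1)), Real.log p / (p * (p - 1)) ≤ A := by
        intro acc' h' hinv'
        have := headGo_sound fuel (k + 1) acc' A h' hinv'
        rwa [show k + 1 + fuel = k + (fuel + 1) by ring] at this
      by_cases hp : isPrimeB k = true
      · rw [if_pos hp] at h
        have hpk : k.Prime := (isPrimeB_iff k).1 hp
        rcases hl : logIv k with _ | ⟨lg, hi⟩
        · simp [hl] at h
        · simp only [hl] at h
          refine hstep _ h ?_
          rw [Nat.primesBelow_succ, if_pos hpk, Finset.sum_insert (Nat.notMem_primesBelow k),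
            mul_add]
          have hk2 : 2 ≤ k := hpk.two_le
          have hk2' : (2 : ℝ) ≤ k := by exact_mod_cast hk2
          have hkk : 0 < k * (k - 1) := Nat.mul_pos (by omega) (by omega)
          have hkkR : ((k * (k - 1) : ℕ) : ℝ) = (k : ℝ) * (k - 1) := by
            rw [Nat.cast_mul, Nat.cast_sub (by omega), Nat.cast_one]
          have hlog := (logIv_sound hl).2
          -- `2⁸⁰ log k/(k(k−1)) ≤ hi/(k(k−1)) ≤ ⌊hi/(k(k−1))⌋ + 1`
          have h1 : (SC : ℝ) * (Real.log k / (k * (k - 1))) ≤ (hi : ℝ) / ((k * (k - 1) : ℕ) : ℝ) := by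
            rw [hkkR, SC]; push_cast
            rw [mul_div_assoc', div_le_div_iff_of_pos_right (by nlinarith)]
            have : Real.log k ≤ (hi : ℝ) / 2 ^ 80 := hlog
            have h80 : (0 : ℝ) < 2 ^ 80 := by positivity
            rw [le_div_iff₀ h80] at this
            linarith
          have h2 := div_le_ediv_add_one hi hkk
          rw [Int.cast_add, Int.cast_add, Int.cast_one]
          linarith
      · rw [if_neg hp] at h
        refine hstep _ h ?_
        have hpk : ¬ k.Prime := fun hh => hp ((isPrimeB_iff k).2 hh)
        rwa [Nat.primesBelow_succ, if_neg hpk]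

/-- Soundness of `headCheck`: `∑_{p ≤ n} log p/(p(p−1)) ≤ C/2⁸⁰` for every `n`. [folklore] -/
private theorem sum_le_of_headCheck {M : ℕ} {C : ℤ} (hM : 2 ≤ M) (h : headCheck M C = true) (n : ℕ) :
    ∑ p ∈ Nat.primesLE n, Real.log p / (p * (p - 1)) ≤ (C : ℝ) / SC := by
  rw [headCheck] at h
  rcases hA : headGo (M - 1) 2 0 with _ | A
  · simp [hA] at h
  rcases hL : logIv M with _ | ⟨lgM, hiM⟩
  · simp [hA, hL] at h
  simp only [hA, hL, decide_eq_true_eq] at h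
  have hSC : (0 : ℝ) < SC := by rw [SC]; positivity
  -- the head
  have hhead : (SC : ℝ) * ∑ p ∈ Nat.primesLE M, Real.log p / (p * (p - 1)) ≤ A := by
    have h0 : (SC : ℝ) * ∑ p ∈ Nat.primesBelow 2, Real.log p / (p * (p - 1)) ≤ (0 : ℤ) := by
      simp [show Nat.primesBelow 2 = ∅ by decide]
    have := headGo_sound (M - 1) 2 0 A hA h0
    rwa [show 2 + (M - 1) = M + 1 by omega] at this
  -- the tail constant
  have hM0 : (0 : ℝ) < M := by exact_mod_cast (show 0 < M by omega)
  have htailc : (SC : ℝ) * ((2 + Real.log M) / M) ≤ (((2 * (SC : ℤ) + hiM) / (M : ℤ) : ℤ) : ℝ) + 1 := by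
    have hlog := (logIv_sound hL).2
    have h1 : (SC : ℝ) * ((2 + Real.log M) / M) ≤ ((2 * (SC : ℤ) + hiM : ℤ) : ℝ) / (M : ℕ) := by
      push_cast
      rw [mul_div_assoc', div_le_div_iff_of_pos_right hM0, SC]
      push_cast
      have h80 : (0 : ℝ) < 2 ^ 80 := by positivity
      have : Real.log M ≤ (hiM : ℝ) / 2 ^ 80 := hlog
      rw [le_div_iff₀ h80] at this
      linarith
    have h2 := div_le_ediv_add_one (2 * (SC : ℤ) + hiM) (show 0 < M by omega)
    exact h1.trans h2
  -- split the sum at `M`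
  have hf0 := log_div_mul_pred_nonneg
  rcases le_or_gt n M with hnM | hnM
  · have hsub : Nat.primesLE n ⊆ Nat.primesLE M := Nat.primesLE_mono hnM
    have h1 : ∑ p ∈ Nat.primesLE n, Real.log p / (p * (p - 1)) ≤
        ∑ p ∈ Nat.primesLE M, Real.log p / (p * (p - 1)) :=
      Finset.sum_le_sum_of_subset_of_nonneg hsub fun k _ _ => hf0 k
    rw [le_div_iff₀ hSC]
    have htc0 : (0 : ℝ) ≤ (SC : ℝ) * ((2 + Real.log M) / M) :=
      mul_nonneg hSC.le (div_nonneg (by linarith [Real.log_natCast_nonneg M]) hM0.le)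
    have hC : (A : ℝ) + ((((2 * (SC : ℤ) + hiM) / (M : ℤ) : ℤ) : ℝ) + 1) ≤ C := by exact_mod_cast h
    nlinarith
  · -- `n > M`: head over `primesLE M`, tail inside `Icc (M+1) n`
    have hsplit : ∑ p ∈ Nat.primesLE n, Real.log p / (p * (p - 1)) =
        ∑ p ∈ (Nat.primesLE n).filter (· ≤ M), Real.log p / (p * (p - 1)) +
          ∑ p ∈ (Nat.primesLE n).filter (fun p => ¬ p ≤ M), Real.log p / (p * (p - 1)) :=
      (Finset.sum_filter_add_sum_filter_not _ _ _).symm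
    have h1 : ∑ p ∈ (Nat.primesLE n).filter (· ≤ M), Real.log p / (p * (p - 1)) ≤
        ∑ p ∈ Nat.primesLE M, Real.log p / (p * (p - 1)) := by
      refine Finset.sum_le_sum_of_subset_of_nonneg (fun p hp => ?_) fun k _ _ => hf0 k
      rw [Finset.mem_filter, Nat.mem_primesLE] at hp
      exact Nat.mem_primesLE.2 ⟨hp.2, hp.1.2⟩
    have h2 : ∑ p ∈ (Nat.primesLE n).filter (fun p => ¬ p ≤ M), Real.log p / (p * (p - 1)) ≤
        ∑ k ∈ Icc (M + 1) n, Real.log k / (k * (k - 1)) := by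
      refine Finset.sum_le_sum_of_subset_of_nonneg (fun p hp => ?_) fun k _ _ => hf0 k
      rw [Finset.mem_filter, Nat.mem_primesLE] at hp
      exact Finset.mem_Icc.2 ⟨by omega, hp.1.1⟩
    have h3 := sum_Icc_log_div_mul_pred_le_from M (by omega) n hnM.le
    have hn0 : (0 : ℝ) < n := by exact_mod_cast (show 0 < n by omega)
    have h4 : 0 ≤ (2 + Real.log n) / n := div_nonneg (by linarith [Real.log_natCast_nonneg n]) hn0.le
    rw [le_div_iff₀ hSC, hsplit]
    have hC : (A : ℝ) + ((((2 * (SC : ℤ) + hiM) / (M : ℤ) : ℤ) : ℝ) + 1) ≤ C := by exact_mod_cast h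
    nlinarith

/-- `⌊0.8615 · 2⁸⁰⌋`, the scaled constant `C₁`. [folklore] -/
def C1NUM : ℤ := ⌊(8615 / 10000 : ℚ) * 2 ^ 80⌋

/-- Kernel evaluation: the head over the primes `≤ 47` plus the tail constant `(2 + log 47)/47` is at
most `0.8615` (true value `0.73662 + 0.12447 = 0.86109`). [folklore] -/
private theorem headCheck_47 : headCheck 47 C1NUM = true := by decide +kernel

/-- **`∑_{p ≤ n} log p/(p(p−1)) ≤ 0.8615`** for every `n` (the full series is `−E − γ = 0.75536…`,
Rosser–Schoenfeld's `E = −γ − ∑_p (log p)/(p(p−1)) = −1.33258…`; the tree's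
`MertensBound.sum_log_div_mul_pred_le_two` has `2`). [cite: RosserSchoenfeld1962, (2.8) and (2.11)] -/
theorem sum_primesLE_log_div_mul_pred_le (n : ℕ) :
    ∑ p ∈ Nat.primesLE n, Real.log p / (p * (p - 1)) ≤ 0.8615 := by
  have h := sum_le_of_headCheck (by norm_num) headCheck_47 n
  refine h.trans ?_
  have hSC : (0 : ℝ) < SC := by rw [SC]; positivity
  rw [div_le_iff₀ hSC, C1NUM, SC]
  have h1 : ((⌊(8615 / 10000 : ℚ) * 2 ^ 80⌋ : ℤ) : ℚ) ≤ (8615 / 10000 : ℚ) * 2 ^ 80 := Int.floor_le _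
  have h2 : (((⌊(8615 / 10000 : ℚ) * 2 ^ 80⌋ : ℤ) : ℚ) : ℝ) ≤ (((8615 / 10000 : ℚ) * 2 ^ 80 : ℚ) : ℝ) := by
    exact_mod_cast h1
  push_cast at h2 ⊢
  linarith

/-! ### 4. The lower bound for `τ(t) = ∑_{p ≤ t} log p/p − log t` -/

/-- **Mertens I, lower half, sharpened**: `log n − 1.8615 ≤ ∑_{p ≤ n} log p/p` for every `n ≥ 1`
(`n log n − n ≤ log n! ≤ n ∑_{p≤n} log p/p + n ∑_{p≤n} log p/(p(p−1))`, as in the tree's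
`MertensBound.log_sub_three_le_sum_log_div_prime`). [cite: HardyWright2008, Thm 425 (§22.6)] -/
theorem log_sub_le_sum_log_div_prime (n : ℕ) (hn : 1 ≤ n) :
    Real.log n - 1.8615 ≤ ∑ p ∈ Nat.primesLE n, Real.log p / p := by
  have hn' : (0 : ℝ) < n := by exact_mod_cast hn
  have h1 := MertensBound.mul_log_sub_le_log_factorial n
  have h2 := MertensBound.log_factorial_le_sum n
  have h3 := sum_primesLE_log_div_mul_pred_le n
  have hsplit : ∑ p ∈ Nat.primesLE n, (n : ℝ) / (p - 1) * Real.log p =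
      n * (∑ p ∈ Nat.primesLE n, Real.log p / p +
        ∑ p ∈ Nat.primesLE n, Real.log p / (p * (p - 1))) := by
    rw [← Finset.sum_add_distrib, Finset.mul_sum]
    refine Finset.sum_congr rfl fun p hp => ?_
    have hp1 : (1 : ℝ) < p := by exact_mod_cast (Nat.mem_primesLE.mp hp).2.one_lt
    have : (p : ℝ) - 1 ≠ 0 := by linarith
    have : (p : ℝ) ≠ 0 := by linarith
    field_simp
    ring
  rw [hsplit] at h2
  have h4 : (n : ℝ) * (Real.log n - 1.8615) ≤ n * ∑ p ∈ Nat.primesLE n, Real.log p / p := by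
    nlinarith
  exact le_of_mul_le_mul_left h4 hn'

/-- **`τ(t) ≥ −1.8615 − 1/⌊t⌋`** for real `t ≥ 1` (`log t ≤ log ⌊t⌋ + log(1 + 1/⌊t⌋)`).
[cite: HardyWright2008, Thm 425 (§22.6)] -/
theorem mertensTau_ge {t : ℝ} (ht : 1 ≤ t) :
    -1.8615 - 1 / (⌊t⌋₊ : ℝ) ≤ mertensTau t := by
  set n := ⌊t⌋₊ with hn
  have hn1 : 1 ≤ n := Nat.le_floor (by simpa using ht)
  have hnR : (1 : ℝ) ≤ n := by exact_mod_cast hn1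
  have hn0 : (0 : ℝ) < n := by linarith
  have htn : t < n + 1 := Nat.lt_floor_add_one t
  have h1 := log_sub_le_sum_log_div_prime n hn1
  -- `log t ≤ log (n+1) = log n + log (1 + 1/n) ≤ log n + 1/n`
  have h2 : Real.log t ≤ Real.log n + 1 / n := by
    have ht0 : 0 < t := by linarith
    have hle : Real.log t ≤ Real.log (n + 1) := Real.log_le_log ht0 htn.le
    have hsplit : Real.log ((n : ℝ) + 1) = Real.log n + Real.log (1 + 1 / n) := by
      rw [← Real.log_mul hn0.ne' (by positivity)]
      congr 1; field_simp
    have h3 : Real.log (1 + 1 / (n : ℝ)) ≤ 1 / n := by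
      have := Real.log_le_sub_one_of_pos (show (0 : ℝ) < 1 + 1 / n by positivity)
      linarith
    linarith
  rw [mertensTau, primeLogDivSum]
  linarith

/-! ### 5. One-sided Mertens II with an explicit constant -/

/-- **One-sided explicit Mertens second theorem**: for real `x ≥ 2`,
`∑_{p ≤ x} 1/p ≤ log log x + B₁ + (1.8615 + 1/⌊x⌋)/log x`, `B₁` the Meissel–Mertens constant
(Hardy–Wright (22.7.3) with `τ(x) < 0` (Rosser–Schoenfeld (3.24)) and `τ ≥ −1.8615 − 1/⌊x⌋` on
`[x, ∞)`). Rosser–Schoenfeld's (3.20) has `1/(2 log² x)` (`x ≥ 286`) from explicit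
prime-number-theorem input; this bound is elementary. [cite: HardyWright2008, §22.7 eq. (22.7.3)] -/
theorem primeRecipSum_le_loglog_add {x : ℝ} (hx : 2 ≤ x) :
    primeRecipSum x ≤ Real.log (Real.log x) + meisselMertens + (1.8615 + 1 / (⌊x⌋₊ : ℝ)) / Real.log x := by
  have hlog : 0 < Real.log x := Real.log_pos (by linarith)
  have hid := primeRecipSum_sub_loglog_sub_eq hx 0
  simp only [sub_zero] at hid
  set L : ℝ := 1.8615 + 1 / (⌊x⌋₊ : ℝ) with hL
  have hx1 : (1 : ℝ) ≤ ⌊x⌋₊ := by exact_mod_cast Nat.le_floor (show ((1 : ℕ) : ℝ) ≤ x by norm_num; linarith)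
  have hL0 : 0 ≤ L := by rw [hL]; positivity
  -- `τ(x) < 0`
  have htau : mertensTau x < 0 := by
    have h := RosserSchoenfeld1962_eq_3_24_holds x (by linarith)
    rw [mertensTau, primeLogDivSum]; linarith
  have hterm1 : mertensTau x / Real.log x ≤ 0 := div_nonpos_of_nonpos_of_nonneg htau.le hlog.le
  -- `−∫_x^∞ τ w ≤ L ∫_x^∞ w = L/log x`
  have hw : IntegrableOn (fun t : ℝ ↦ t⁻¹ / Real.log t ^ 2) (Ioi x) :=
    integrableOn_inv_div_log_sq.mono_set (Ioi_subset_Ioi hx)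
  have hτw : IntegrableOn (fun t ↦ mertensTau t * (t⁻¹ / Real.log t ^ 2)) (Ioi x) :=
    integrableOn_mertensTau_mul.mono_set (Ioi_subset_Ioi hx)
  have hmono : ∫ t in Ioi x, (-L) * (t⁻¹ / Real.log t ^ 2) ≤
      ∫ t in Ioi x, mertensTau t * (t⁻¹ / Real.log t ^ 2) := by
    refine setIntegral_mono_on (hw.const_mul _) hτw measurableSet_Ioi fun t ht => ?_
    have hxt : x < t := ht
    have ht1 : 1 ≤ t := by linarith
    have hwt : 0 ≤ t⁻¹ / Real.log t ^ 2 := by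
      have : 0 < t := by linarith
      positivity
    have hfl : (⌊x⌋₊ : ℝ) ≤ ⌊t⌋₊ := by exact_mod_cast Nat.floor_le_floor hxt.le
    have hflx : (0 : ℝ) < ⌊x⌋₊ := by linarith
    have hLt : -L ≤ mertensTau t := by
      have h := mertensTau_ge ht1
      have : 1 / (⌊t⌋₊ : ℝ) ≤ 1 / (⌊x⌋₊ : ℝ) := one_div_le_one_div_of_le hflx hfl
      rw [hL]; linarith
    exact mul_le_mul_of_nonneg_right hLt hwt
  rw [integral_const_mul, integral_Ioi_inv_div_log_sq hx] at hmono
  have hterm2 : -(∫ t in Ioi x, mertensTau t * (t⁻¹ / Real.log t ^ 2)) ≤ L / Real.log x := by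
    rw [div_eq_mul_inv]; linarith
  linarith

/-! ### 6. `γ − B₁ ≥ 0.3113` -/

/-- `−log(1 − 1/p) − 1/p ≥ ∑_{n < J} (1/p)^{n+1}/(n+1) − 1/p` (a partial sum of the series
`−log(1 − u) = ∑ u^{n+1}/(n+1)`, nonnegative terms). [cite: HardyWright2008, §22.7 eq. (22.7.1)] -/
theorem sum_pow_div_sub_inv_le_primeLogCoeffSubInv {p : ℕ} (hp : p.Prime) (J : ℕ) :
    ∑ n ∈ Finset.range J, ((p : ℝ)⁻¹) ^ (n + 1) / (n + 1) - (p : ℝ)⁻¹ ≤ primeLogCoeffSubInv p := by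
  rw [primeLogCoeffSubInv, if_pos hp]
  have hp2 : (2 : ℝ) ≤ p := by exact_mod_cast hp.two_le
  have hu0 : 0 ≤ (p : ℝ)⁻¹ := by positivity
  have hu1 : |(p : ℝ)⁻¹| < 1 := by
    rw [abs_of_nonneg hu0, inv_eq_one_div, div_lt_one (by linarith)]; linarith
  have hs := Real.hasSum_pow_div_log_of_abs_lt_one hu1
  have hle := sum_le_hasSum (Finset.range J) (fun n _ => by positivity) hs
  linarith

/-- **`γ − B₁ ≥ 0.3113`** (true value `0.31571…`, Rosser–Schoenfeld (2.7), (2.10):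
`B = γ + ∑_p {log(1 − 1/p) + 1/p} = 0.26149 72128…`): from `γ − B₁ = ∑_p (−log(1 − 1/p) − 1/p)`
(Hardy–Wright Thm 428) and the primes `p ≤ 23` with `J`-term partial sums.
[cite: RosserSchoenfeld1962, (2.7) and (2.10)] -/
theorem eulerMascheroni_sub_meisselMertens_ge :
    0.3113 ≤ Real.eulerMascheroniConstant - meisselMertens := by
  have htsum : Real.eulerMascheroniConstant - meisselMertens = ∑' k, primeLogCoeffSubInv k := by
    rw [tsum_primeLogCoeffSubInv, meisselMertens]; ring
  rw [htsum]
  have hnonneg : ∀ k, 0 ≤ primeLogCoeffSubInv k := fun k => by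
    by_cases hk : k.Prime
    · have := sum_pow_div_sub_inv_le_primeLogCoeffSubInv hk 1
      simp at this
      linarith
    · simp [primeLogCoeffSubInv, hk]
  have hpart : ∑ k ∈ ({2, 3, 5, 7, 11, 13, 17, 19, 23} : Finset ℕ), primeLogCoeffSubInv k ≤
      ∑' k, primeLogCoeffSubInv k :=
    summable_primeLogCoeffSubInv.sum_le_tsum _ fun k _ => hnonneg k
  refine le_trans ?_ hpart
  rw [Finset.sum_insert (by decide), Finset.sum_insert (by decide), Finset.sum_insert (by decide),
    Finset.sum_insert (by decide), Finset.sum_insert (by decide), Finset.sum_insert (by decide),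
    Finset.sum_insert (by decide), Finset.sum_insert (by decide), Finset.sum_singleton]
  have h2 := sum_pow_div_sub_inv_le_primeLogCoeffSubInv Nat.prime_two 13
  have h3 := sum_pow_div_sub_inv_le_primeLogCoeffSubInv Nat.prime_three 9
  have h5 := sum_pow_div_sub_inv_le_primeLogCoeffSubInv Nat.prime_five 6
  have h7 := sum_pow_div_sub_inv_le_primeLogCoeffSubInv (by norm_num : Nat.Prime 7) 6
  have h11 := sum_pow_div_sub_inv_le_primeLogCoeffSubInv (by norm_num : Nat.Prime 11) 4
  have h13 := sum_pow_div_sub_inv_le_primeLogCoeffSubInv (by norm_num : Nat.Prime 13) 4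
  have h17 := sum_pow_div_sub_inv_le_primeLogCoeffSubInv (by norm_num : Nat.Prime 17) 3
  have h19 := sum_pow_div_sub_inv_le_primeLogCoeffSubInv (by norm_num : Nat.Prime 19) 3
  have h23 := sum_pow_div_sub_inv_le_primeLogCoeffSubInv (by norm_num : Nat.Prime 23) 3
  simp only [Finset.sum_range_succ, Finset.sum_range_zero] at h2 h3 h5 h7 h11 h13 h17 h19 h23
  norm_num at h2 h3 h5 h7 h11 h13 h17 h19 h23 ⊢
  linarith

/-- **`B₁ < 0.2660`** for the Meissel–Mertens constant (Rosser–Schoenfeld (2.10):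
`B = 0.26149 72128 47643`; the tree had `B₁ ≤ 13`). [cite: RosserSchoenfeld1962, (2.10)] -/
theorem meisselMertens_lt : meisselMertens < 0.2660 := by
  have h1 := eulerMascheroni_sub_meisselMertens_ge
  have h2 := Literature.Analysis.SpecialFunctions.Real.eulerMascheroniConstant_lt_d8
  linarith

/-! ### 7. The analytic range `x ≥ 420` -/

/-- The check `c ≤ lg` for the kernel enclosure `lg/2⁸⁰ ≤ log n`. [folklore] -/
def logGeCheck (n : ℕ) (c : ℤ) : Bool :=
  match logIv n with
  | none => false
  | some (lg, _) => decide (c ≤ lg)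

/-- Soundness of `logGeCheck`: `c/2⁸⁰ ≤ log n`. [folklore] -/
private theorem le_log_of_logGeCheck {n : ℕ} {c : ℤ} (h : logGeCheck n c = true) :
    (c : ℝ) / 2 ^ 80 ≤ Real.log n := by
  rw [logGeCheck] at h
  rcases hl : logIv n with _ | ⟨lg, hi⟩
  · simp [hl] at h
  simp only [hl, decide_eq_true_eq] at h
  have h1 := (logIv_sound hl).1
  have hc : (c : ℝ) ≤ lg := by exact_mod_cast h
  have : (c : ℝ) / 2 ^ 80 ≤ (lg : ℝ) / 2 ^ 80 := div_le_div_of_nonneg_right hc (by positivity)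
  exact this.trans h1

/-- `log 420 ≥ 6.04` (kernel logarithm; true value `6.0402…`). [folklore] -/
private theorem log_420_ge : (6.04 : ℝ) ≤ Real.log 420 := by
  have h : logGeCheck 420 ⌈(604 / 100 : ℚ) * 2 ^ 80⌉ = true := by decide +kernel
  have h1 := le_log_of_logGeCheck h
  have e : ((420 : ℕ) : ℝ) = 420 := by norm_num
  rw [e] at h1
  refine le_trans ?_ h1
  have h2 : (604 / 100 : ℚ) * 2 ^ 80 ≤ ((⌈(604 / 100 : ℚ) * 2 ^ 80⌉ : ℤ) : ℚ) := Int.le_ceil _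
  have h3 : (((604 / 100 : ℚ) * 2 ^ 80 : ℚ) : ℝ) ≤ ((((⌈(604 / 100 : ℚ) * 2 ^ 80⌉ : ℤ) : ℚ)) : ℝ) := by
    exact_mod_cast h2
  push_cast at h3
  rw [le_div_iff₀ (by positivity)]
  linarith

/-- `∑_{p ≤ x} 1/p ≤ log log x + γ` for real `x ≥ 420`. [cite: CLMS2007, Lemma 2.1 (2)] -/
theorem primeRecipSum_le_loglog_add_eulerMascheroni_of_ge {x : ℝ} (hx : 420 ≤ x) :
    primeRecipSum x ≤ Real.log (Real.log x) + Real.eulerMascheroniConstant := by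
  have h1 := primeRecipSum_le_loglog_add (show (2 : ℝ) ≤ x by linarith)
  have h2 := eulerMascheroni_sub_meisselMertens_ge
  have hlog420 := log_420_ge
  have hlogx : Real.log 420 ≤ Real.log x := Real.log_le_log (by norm_num) hx
  have hlx : (6.04 : ℝ) ≤ Real.log x := hlog420.trans hlogx
  have hfl : (420 : ℝ) ≤ ⌊x⌋₊ := by
    have : (420 : ℕ) ≤ ⌊x⌋₊ := Nat.le_floor (by exact_mod_cast hx)
    exact_mod_cast this
  have hL : 1.8615 + 1 / (⌊x⌋₊ : ℝ) ≤ 1.8615 + 1 / 420 := by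
    have := one_div_le_one_div_of_le (by norm_num : (0 : ℝ) < 420) hfl
    linarith
  have hrem : (1.8615 + 1 / (⌊x⌋₊ : ℝ)) / Real.log x ≤ 0.3113 := by
    rw [div_le_iff₀ (by linarith)]
    nlinarith
  linarith

/-! ### 8. The range `4 ≤ ⌊x⌋ < 420` by kernel computation -/

/-- `⌊0.57721558 · 2⁸⁰⌋`, a scaled lower bound for `γ` (`EulerMascheroniBounds.lean`). [folklore] -/
def GAMMALO : ℤ := ⌊(57721558 / 100000000 : ℚ) * 2 ^ 80⌋

/-- A scaled lower bound for `log log n`: `v/2⁸⁰ ≤ log log n`, from two kernel logarithms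
(`log log n ≥ log(lg) − 80 log 2` where `lg/2⁸⁰ ≤ log n`); `none` if unavailable. [folklore] -/
def loglogLo (n : ℕ) : Option ℤ :=
  match logIv n with
  | none => none
  | some (lg, _) =>
      if 0 < lg then
        match logIv lg.toNat with
        | none => none
        | some (lg2, _) => some (lg2 - 80 * L2HI)
      else none

/-- The main checker over `n, n+1, …` (`fuel` steps): `S` over-estimates `2⁸⁰ ∑_{p < n} 1/p`; at
each `n` add `⌊2⁸⁰/n⌋ + 1` if `n` is prime and check `S ≤ GAMMALO + loglogLo n`. [folklore] -/
def checkGo : ℕ → ℕ → ℤ → Bool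
  | 0, _, _ => true
  | fuel + 1, n, S =>
      let S' := if isPrimeB n = true then S + ((SC / n : ℕ) : ℤ) + 1 else S
      (match loglogLo n with
        | none => false
        | some v => decide (S' ≤ GAMMALO + v)) && checkGo fuel (n + 1) S'

/-- The initial over-estimate of `2⁸⁰ (1/2 + 1/3)`. [folklore] -/
def S4 : ℤ := ((SC / 2 + SC / 3 + 2 : ℕ) : ℤ)

/-- `80 log 2 ≤ 80 L2HI/2⁸⁰`. [folklore] -/
private theorem eighty_log_two_le : 80 * Real.log 2 ≤ ((80 * L2HI : ℤ) : ℝ) / 2 ^ 80 := by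
  have h1 : (0.69314718055994530944 : ℚ) * 2 ^ 80 ≤ ((L2HI : ℤ) : ℚ) := Int.le_ceil _
  have h2 : (((0.69314718055994530944 : ℚ) * 2 ^ 80 : ℚ) : ℝ) ≤ (((L2HI : ℤ) : ℚ) : ℝ) := by
    exact_mod_cast h1
  have h3 := Literature.Analysis.SpecialFunctions.Real.log_two_lt_d20
  push_cast at h2 ⊢
  rw [le_div_iff₀ (by positivity)]
  nlinarith

/-- Soundness of `loglogLo`. [folklore] -/
private theorem loglogLo_sound {n : ℕ} {v : ℤ} (h : loglogLo n = some v) :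
    (v : ℝ) / 2 ^ 80 ≤ Real.log (Real.log n) := by
  rw [loglogLo] at h
  rcases hl : logIv n with _ | ⟨lg, hi⟩
  · simp [hl] at h
  simp only [hl] at h
  by_cases hlg : 0 < lg
  · rw [if_pos hlg] at h
    rcases hl2 : logIv lg.toNat with _ | ⟨lg2, hi2⟩
    · simp [hl2] at h
    simp only [hl2, Option.some.injEq] at h
    subst h
    have h1 := (logIv_sound hl).1
    have h2 := (logIv_sound hl2).1
    have hlgR : ((lg.toNat : ℕ) : ℝ) = (lg : ℝ) := by
      have : ((lg.toNat : ℕ) : ℤ) = lg := Int.toNat_of_nonneg hlg.le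
      exact_mod_cast this
    rw [hlgR] at h2
    have hlg0 : (0 : ℝ) < lg := by exact_mod_cast hlg
    have h80 : (0 : ℝ) < 2 ^ 80 := by positivity
    -- `log log n ≥ log (lg/2^80) = log lg − 80 log 2`
    have hpos : 0 < (lg : ℝ) / 2 ^ 80 := by positivity
    have h3 : Real.log ((lg : ℝ) / 2 ^ 80) ≤ Real.log (Real.log n) := Real.log_le_log hpos h1
    have h4 : Real.log ((lg : ℝ) / 2 ^ 80) = Real.log lg - 80 * Real.log 2 := by
      rw [Real.log_div hlg0.ne' h80.ne', Real.log_pow]; norm_num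
    have h5 := eighty_log_two_le
    rw [h4] at h3
    have : ((lg2 - 80 * L2HI : ℤ) : ℝ) / 2 ^ 80 = (lg2 : ℝ) / 2 ^ 80 - ((80 * L2HI : ℤ) : ℝ) / 2 ^ 80 := by
      push_cast; ring
    rw [this]
    linarith
  · rw [if_neg hlg] at h
    simp at h

/-- `γ ≥ GAMMALO/2⁸⁰`. [folklore] -/
private theorem gammalo_le : ((GAMMALO : ℤ) : ℝ) / 2 ^ 80 ≤ Real.eulerMascheroniConstant := by
  have h1 : ((GAMMALO : ℤ) : ℚ) ≤ (57721558 / 100000000 : ℚ) * 2 ^ 80 := Int.floor_le _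
  have h2 : (((GAMMALO : ℤ) : ℚ) : ℝ) ≤ (((57721558 / 100000000 : ℚ) * 2 ^ 80 : ℚ) : ℝ) := by
    exact_mod_cast h1
  have h3 := Literature.Analysis.SpecialFunctions.Real.eulerMascheroniConstant_gt_d8
  push_cast at h2 ⊢
  rw [div_le_iff₀ (by positivity)]
  nlinarith

/-- `∑_{p ≤ n} 1/p` over `primesLE n` is `primeRecipSum n`. [folklore] -/
private theorem primeRecipSum_natCast (n : ℕ) :
    primeRecipSum (n : ℝ) = ∑ p ∈ Nat.primesLE n, (p : ℝ)⁻¹ := by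
  rw [primeRecipSum, Nat.floor_natCast]

/-- Soundness of `checkGo`: with `2⁸⁰ ∑_{p < n} 1/p ≤ S`, a successful run gives
`∑_{p ≤ m} 1/p ≤ γ + log log m` for `n ≤ m < n + fuel`. [folklore] -/
private theorem checkGo_sound : ∀ (fuel n : ℕ) (S : ℤ), checkGo fuel n S = true →
    (SC : ℝ) * ∑ p ∈ Nat.primesBelow n, (p : ℝ)⁻¹ ≤ S →
    ∀ m : ℕ, n ≤ m → m < n + fuel →
      primeRecipSum (m : ℝ) ≤ Real.log (Real.log m) + Real.eulerMascheroniConstant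
  | 0, n, S, _, _, m, h1, h2 => by omega
  | fuel + 1, n, S, h, hinv, m, h1, h2 => by
      simp only [checkGo, Bool.and_eq_true] at h
      obtain ⟨hchk, hrest⟩ := h
      have hSC : (0 : ℝ) < SC := by rw [SC]; positivity
      set S' : ℤ := if isPrimeB n = true then S + ((SC / n : ℕ) : ℤ) + 1 else S with hS'
      -- the invariant at `n + 1`
      have hinv' : (SC : ℝ) * ∑ p ∈ Nat.primesBelow (n + 1), (p : ℝ)⁻¹ ≤ S' := by
        rw [Nat.primesBelow_succ]
        by_cases hp : n.Prime
        · have hpb : isPrimeB n = true := (isPrimeB_iff n).2 hp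
          rw [if_pos hp, Finset.sum_insert (Nat.notMem_primesBelow n), mul_add, hS', if_pos hpb]
          have hn0 : 0 < n := hp.pos
          have hn0R : (0 : ℝ) < n := by exact_mod_cast hn0
          -- `2⁸⁰/n ≤ ⌊2⁸⁰/n⌋ + 1`
          have hdiv : (SC : ℝ) * (n : ℝ)⁻¹ ≤ ((SC / n : ℕ) : ℝ) + 1 := by
            rw [← div_eq_mul_inv, div_le_iff₀ hn0R]
            have h := Nat.lt_div_mul_add hn0 (a := SC)
            have h' : (SC : ℝ) < ((SC / n : ℕ) : ℝ) * n + n := by exact_mod_cast h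
            nlinarith
          rw [Int.cast_add, Int.cast_add, Int.cast_one, Int.cast_natCast]
          linarith
        · have hpb : ¬ isPrimeB n = true := fun hh => hp ((isPrimeB_iff n).1 hh)
          rw [if_neg hp, hS', if_neg hpb]
          exact hinv
      rcases Nat.eq_or_lt_of_le h1 with rfl | hlt
      · -- the check at `n`
        rcases hv : loglogLo n with _ | v
        · simp [hv] at hchk
        · simp only [hv, decide_eq_true_eq] at hchk
          have hll := loglogLo_sound hv
          have hγ := gammalo_le
          have hsum : primeRecipSum (n : ℝ) = ∑ p ∈ Nat.primesBelow (n + 1), (p : ℝ)⁻¹ := by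
            rw [primeRecipSum_natCast]; rfl
          have hchkR : ((S' : ℤ) : ℝ) ≤ ((GAMMALO : ℤ) : ℝ) + (v : ℝ) := by exact_mod_cast hchk
          rw [hsum]
          have h80 : (SC : ℝ) = 2 ^ 80 := by rw [SC]; norm_num
          rw [h80] at hinv'
          have : ∑ p ∈ Nat.primesBelow (n + 1), (p : ℝ)⁻¹ ≤ ((S' : ℤ) : ℝ) / 2 ^ 80 := by
            rw [le_div_iff₀ (by positivity)]; linarith
          linarith
      · exact checkGo_sound fuel (n + 1) S' hrest hinv' m hlt (by omega)

set_option maxRecDepth 100000 in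
/-- Kernel evaluation of the main checker on `4 ≤ n < 420` (`416` steps, two kernel logarithms
each). [folklore] -/
private theorem check_4_420 : checkGo 416 4 S4 = true := by decide +kernel

/-- `∑_{p ≤ n} 1/p ≤ log log n + γ` for naturals `4 ≤ n < 420`. [cite: CLMS2007, Lemma 2.1 (2)] -/
theorem primeRecipSum_le_loglog_add_eulerMascheroni_of_lt {n : ℕ} (h4 : 4 ≤ n) (h420 : n < 420) :
    primeRecipSum (n : ℝ) ≤ Real.log (Real.log n) + Real.eulerMascheroniConstant := by
  refine checkGo_sound 416 4 S4 check_4_420 ?_ n h4 (by omega)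
  -- `2⁸⁰ (1/2 + 1/3) ≤ S4`
  have hpb : Nat.primesBelow 4 = {2, 3} := by decide
  rw [hpb, Finset.sum_insert (by decide), Finset.sum_singleton, S4, SC]
  push_cast
  norm_num

end PrimeRecipSumBound

open PrimeRecipSumBound

/-- **`∑_{p ≤ x} 1/p ≤ log log x + γ` for every real `x ≥ 4`** (CLMS print `x ≥ 5`; at `x = 4`:
`5/6 < 0.9038`; it fails on `[3, 4)`). Unconditional: one-sided explicit Mertens II for
`x ≥ 420`, kernel computation below. [cite: CLMS2007, Lemma 2.1 (2)] -/
theorem primeRecipSum_le_loglog_add_eulerMascheroni {x : ℝ} (hx : 4 ≤ x) :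
    primeRecipSum x ≤ Real.log (Real.log x) + Real.eulerMascheroniConstant := by
  rcases le_or_gt 420 x with h420 | h420
  · exact primeRecipSum_le_loglog_add_eulerMascheroni_of_ge h420
  · set n := ⌊x⌋₊ with hn
    have hx0 : 0 ≤ x := by linarith
    have hn4 : 4 ≤ n := Nat.le_floor (by exact_mod_cast hx)
    have hn420 : n < 420 := (Nat.floor_lt hx0).2 (by exact_mod_cast h420)
    have h := primeRecipSum_le_loglog_add_eulerMascheroni_of_lt hn4 hn420
    have hfloor : primeRecipSum x = primeRecipSum (n : ℝ) := by
      rw [primeRecipSum, primeRecipSum, Nat.floor_natCast]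
    have hnx : (n : ℝ) ≤ x := Nat.floor_le hx0
    have hn1 : (1 : ℝ) < n := by
      have : (4 : ℝ) ≤ n := by exact_mod_cast hn4
      linarith
    have hll : Real.log (Real.log n) ≤ Real.log (Real.log x) :=
      Real.log_le_log (Real.log_pos hn1) (Real.log_le_log (by linarith) hnx)
    rw [hfloor]
    linarith

/-- **CLMS 2007, Lemma 2.1 (2), as printed**: "For `x ≥ 5` we have `∑_{p≤x} 1/p ≤ log log x + γ`."
[cite: CLMS2007, Lemma 2.1 (2)] -/
theorem CLMS2007_lemma_2_1_2 {x : ℝ} (hx : 5 ≤ x) :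
    ∑ p ∈ Nat.primesLE ⌊x⌋₊, (p : ℝ)⁻¹ ≤ Real.log (Real.log x) + Real.eulerMascheroniConstant :=
  primeRecipSum_le_loglog_add_eulerMascheroni (by linarith)

end Literature.NumberTheory.LFunctions
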